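import Literature.AlgebraicGeometry.ComplexMultiplication.FieldOfDegreeTwoDimIsotypic
import Literature.AlgebraicGeometry.Motives.AbelianVarietySimpleOfEndAlgebraDomain
import HarnessLib

/-!
# An abelian variety with complex multiplication by a field `F` is simple iff `End⁰(A) = F`

G. Shimura, *Abelian Varieties with Complex Multiplication and Modular Functions* (1998), §5.1,
Propositions 3–6 and §5.2: for `(A, ι)` of type `(F; Φ)` with `[F : ℚ] = 2 dim A`, `A` is isogenous
to `B × ⋯ × B` with `B` simple (Prop. 3), `End_Q(B)` is a division algebra (p. 40), and
`End_Q(A) ⊇ F` with the commutant of `F` equal to `F`; D. Mumford, *Abelian Varieties* (1970), §19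
Cor. 2 of Thm. 1: `End⁰(A)` is a division algebra iff `A` is simple.  Consequently, for an abelian
variety `A` whose `End⁰(A)` contains a field `F` of degree `2 dim A`:

  `A` simple ⟺ `End⁰(A)` is a field ⟺ `End⁰(A)` is commutative ⟺ `End⁰(A) = F`

(J. S. Milne, *Complex Multiplication* (2006), Prop. 3.6 / Rem. 3.7 states the same dichotomy).  This
file PROVES these equivalences for COMPLEX abelian varieties on the tree's carriers, from the tree's
theorems `Subalgebra.eq_of_le_of_comm_of_isField` (`F` is maximal commutative,
`ComplexMultiplication/FieldOfDegreeTwoDimCommutant`), `isSimple_of_isField_endAlgebra` (a field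
`End⁰` forces simplicity, `Motives/AbelianVarietySimpleOfEndAlgebraDomain`) and
`IsOfCMType.isOfCMTypeSimple` (a simple CM abelian variety has `End⁰` a field of degree `2 dim`,
`Milne1999/CMTypeSimpleIsogenyFactors`):

* `isSimple_iff_forall_exists_mul_eq_one` — Mumford §19 Cor. 2 as an `iff` over any PERFECT field (v2; v1:
  algebraically closed): `X` simple iff every non-zero element of `End⁰(X)` is invertible; `noZeroDivisors_endAlgebra_of_isSimple`
  (any field), `isSimple_iff_noZeroDivisors_endAlgebra` (perfect field);
* `dim_pos_of_isOfCMTypeSimple`, `isSimple_of_isOfCMTypeSimple`,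
  **`isOfCMTypeSimple_iff_isSimple_and_isOfCMType`** — Milne's clause `IsOfCMTypeSimple B`
  (`End⁰(B)` a field of degree `2 dim B`) is equivalent to «`B` simple, of positive dimension and of
  CM-type»; so far the tree had only `⇐` (`IsOfCMType.isOfCMTypeSimple`).
* for a field `F ⊆ End⁰(A)` with `[F : ℚ] = 2 dim A`: **`isSimple_iff_isField_endAlgebra_of_isField`**,
  **`isSimple_iff_endAlgebra_comm_of_isField`**, **`isSimple_iff_eq_top_of_isField`** (`A` simple iff
  `F = End⁰(A)`), `finrank_endAlgebra_eq_of_isSimple_of_isField`;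
* for `φ : K →ₐ[ℚ] End⁰(A)` from a field `K` with `[K : ℚ] = 2 dim A`:
  **`isSimple_iff_surjective_of_algHom`** — `A` is simple iff every element of `End⁰(A)` comes from
  `K` (Shimura's «`End_Q(A) = ι(F)`»).

Theorems only; no definition, no named fact (D-0026).

## References
* [Shimura1998] G. Shimura, *Abelian Varieties with Complex Multiplication and Modular Functions*
  (1998), §5.1 Propositions 3, 4, 6 and p. 40 (held chunks p0048–p0050).
* [MumfordAV1970] D. Mumford, *Abelian Varieties* (1970), §19 Cor. 2 of Thm. 1 (p. 174).
* [Milne1999] J. S. Milne, *Lefschetz motives and the Tate conjecture*, Compositio Math. 117 (1999),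
  §2 p. 54 (CM-type; «`End⁰(B)` a field of degree `2 dim B`»).
* [MilneCM2006] J. S. Milne, *Complex Multiplication* (2006), Ch. I Prop. 3.6, Rem. 3.7 (orientation;
  not held).
-/

noncomputable section

open CategoryTheory

namespace Literature.AlgebraicGeometry.ComplexMultiplication

open Literature.AlgebraicGeometry.Motives
open Literature.AlgebraicGeometry.Milne1999 (IsOfCMType IsOfCMTypeSimple)

/-! ### §1 `A` simple ⟺ `End⁰(A)` a division algebra; Milne's clause `IsOfCMTypeSimple B` is «`B` simple, non-zero, of CM-type» -/

section DivisionAlgebra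

universe u

variable {K : Type u} [Field K] {X : AbelianVariety K}

/-- **`End⁰(X)` of a simple abelian variety has no zero divisors** (any field): it is a division ring
(`endAlgebra_exists_inv_of_isSimple`, Mumford §19 Cor. 2 of Thm. 1: «`End⁰(X)` is a division ring for
simple `X`»). [cite: MumfordAV1970, §19 Cor. 2 of Thm. 1 (p. 174)] [cite: Shimura1998, §5.1 Proposition 4 (proof)] -/
theorem noZeroDivisors_endAlgebra_of_isSimple (hX : X.IsSimple) : NoZeroDivisors X.endAlgebra := by
  refine ⟨fun {x y} hxy => ?_⟩
  by_cases hx : x = 0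
  · exact Or.inl hx
  · obtain ⟨z, -, hzx⟩ := endAlgebra_exists_inv_of_isSimple hX x hx
    refine Or.inr ?_
    calc y = z * x * y := by rw [hzx, one_mul]
      _ = 0 := by rw [mul_assoc, hxy, mul_zero]

variable [PerfectField K]

/-- **Mumford §19, Cor. 2 of Thm. 1: `X` is simple iff `End⁰(X)` is a division algebra** (over a perfect
field; v2 — v1 assumed `K` algebraically closed): `⇒` is the tree's `endAlgebra_exists_inv_of_isSimple`
(any field), `⇐` is `AbelianVariety.isSimple_of_forall_exists_mul_eq_one` (perfect field, through Poincaré's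
complete reducibility `poincare_complete_reducibility_of_perfectField`). [cite: MumfordAV1970, §19 Cor. 2 of Thm. 1 (p. 174)]
[cite: Shimura1998, §5.1 Proposition 4 (proof)] -/
theorem isSimple_iff_forall_exists_mul_eq_one :
    X.IsSimple ↔ ∀ x : X.endAlgebra, x ≠ 0 → ∃ y : X.endAlgebra, x * y = 1 :=
  ⟨fun h x hx => (endAlgebra_exists_inv_of_isSimple h x hx).imp fun _ hy => hy.1,
    AbelianVariety.isSimple_of_forall_exists_mul_eq_one⟩

/-- **`X` is simple iff `End⁰(X)` has no zero divisors** (perfect field; Mumford §19 Cor. 2 of Thm. 1 with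
the converse `AbelianVariety.isSimple_of_noZeroDivisors_endAlgebra`: a non-simple `X` has the zero divisors
`i ∘ p` and its complementary quasi-idempotent). [cite: MumfordAV1970, §19 Thm. 1 and Cor. 2 (pp. 173–174)]
[cite: Shimura1998, §5.1 Proposition 4 (proof)] -/
theorem isSimple_iff_noZeroDivisors_endAlgebra : X.IsSimple ↔ NoZeroDivisors X.endAlgebra :=
  ⟨noZeroDivisors_endAlgebra_of_isSimple, fun h => by
    haveI := h
    exact AbelianVariety.isSimple_of_noZeroDivisors_endAlgebra⟩

end DivisionAlgebra

section MilneClause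

variable {B : AbelianVariety ℂ}

/-- `IsOfCMTypeSimple B` (a FIELD `End⁰(B)` of degree `2 dim B`) forces `0 < dim B`: the zero abelian
variety has `End B = 0`, so `End⁰(B) = ℚ ⊗ 0 = 0` is not a field. [cite: Milne1999, §2 p. 54] -/
theorem dim_pos_of_isOfCMTypeSimple (h : IsOfCMTypeSimple B) : 0 < B.dim := by
  by_contra h0
  have hB : B.dim = 0 := Nat.eq_zero_of_not_pos h0
  haveI : Nontrivial B.endAlgebra := h.1.nontrivial
  have h1 : (1 : End B) = 0 := AbelianVariety.hom_eq_zero_of_dim_eq_zero (Or.inl hB) _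
  exact one_ne_zero (by rw [← map_one (AbelianVariety.endAlgebra.of B), h1, map_zero] :
    (1 : B.endAlgebra) = 0)

/-- **A field `End⁰(B)` forces `B` simple**: `IsOfCMTypeSimple B → B.IsSimple`
(`isSimple_of_isField_endAlgebra`, Mumford §19 Cor. 2). [cite: MumfordAV1970, §19 Cor. 2 of Thm. 1 (p. 174)]
[cite: Milne1999, §2 p. 54] -/
theorem isSimple_of_isOfCMTypeSimple (h : IsOfCMTypeSimple B) : B.IsSimple :=
  AbelianVariety.isSimple_of_isField_endAlgebra h.1

/-- **Milne's clause, characterised**: `End⁰(B)` is a field of degree `2 dim B` iff `B` is simple,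
of positive dimension and of CM-type (`⇐` is the tree's `IsOfCMType.isOfCMTypeSimple`, Shimura §5.1
Props. 3, 4, 6; `⇒` by `isSimple_of_isField_endAlgebra` and `IsOfCMTypeSimple.isOfCMType`).
[cite: Milne1999, §2 p. 54] [cite: Shimura1998, §5.1 Propositions 3, 4, 6] -/
theorem isOfCMTypeSimple_iff_isSimple_and_isOfCMType :
    IsOfCMTypeSimple B ↔ B.IsSimple ∧ 0 < B.dim ∧ IsOfCMType B :=
  ⟨fun h => ⟨isSimple_of_isOfCMTypeSimple h, dim_pos_of_isOfCMTypeSimple h, h.isOfCMType⟩,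
    fun h => h.2.2.isOfCMTypeSimple h.1 h.2.1⟩

end MilneClause

/-! ### §2 CM by a field `F`: `A` simple ⟺ `End⁰(A)` a field ⟺ `End⁰(A)` commutative ⟺ `End⁰(A) = F` -/

section FieldCM

variable {A : AbelianVariety ℂ} (F : Subalgebra ℚ A.endAlgebra)

/-- **`A` simple ⟺ `End⁰(A)` is a field**, for `A` with a field `F ⊆ End⁰(A)` of degree `2 dim A`
(`⇒`: `A` is of CM-type, `isOfCMType_of_isField`, and a simple CM abelian variety has `End⁰` a field,
`IsOfCMType.isOfCMTypeSimple`; `⇐`: `isSimple_of_isField_endAlgebra`).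
[cite: Shimura1998, §5.1 Propositions 3, 4, 6] [cite: MumfordAV1970, §19 Cor. 2 of Thm. 1 (p. 174)] -/
theorem isSimple_iff_isField_endAlgebra_of_isField (hF : IsField F)
    (hdeg : Module.finrank ℚ F = 2 * A.dim) : A.IsSimple ↔ IsField A.endAlgebra :=
  ⟨fun hs => ((isOfCMType_of_isField F hF hdeg).isOfCMTypeSimple hs
      (dim_pos_of_isField_of_finrank_eq F hF hdeg)).1,
    AbelianVariety.isSimple_of_isField_endAlgebra⟩

/-- For simple `A` with a field `F ⊆ End⁰(A)` of degree `2 dim A`, `[End⁰(A) : ℚ] = 2 dim A = [F : ℚ]`.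
[cite: Shimura1998, §5.1 Propositions 3, 4, 6] -/
theorem finrank_endAlgebra_eq_of_isSimple_of_isField (hF : IsField F)
    (hdeg : Module.finrank ℚ F = 2 * A.dim) (hs : A.IsSimple) :
    Module.finrank ℚ A.endAlgebra = 2 * A.dim :=
  ((isOfCMType_of_isField F hF hdeg).isOfCMTypeSimple hs (dim_pos_of_isField_of_finrank_eq F hF hdeg)).2

/-- **`A` simple ⟺ `End⁰(A)` commutative**, for `A` with a field `F ⊆ End⁰(A)` of degree `2 dim A`
(`⇐`: a commutative `End⁰(A)` equals the maximal commutative subalgebra `F`,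
`Subalgebra.eq_of_le_of_comm_of_isField`, hence is a field). [cite: Shimura1998, §5.1 Propositions 3, 6] -/
theorem isSimple_iff_endAlgebra_comm_of_isField (hF : IsField F)
    (hdeg : Module.finrank ℚ F = 2 * A.dim) :
    A.IsSimple ↔ ∀ x y : A.endAlgebra, x * y = y * x := by
  refine ⟨fun hs => ((isSimple_iff_isField_endAlgebra_of_isField F hF hdeg).1 hs).mul_comm,
    fun hcomm => ?_⟩
  have htop : (⊤ : Subalgebra ℚ A.endAlgebra) = F :=
    Subalgebra.eq_of_le_of_comm_of_isField F hF hdeg le_top fun x _ y _ => hcomm x y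
  refine AbelianVariety.isSimple_of_isField_endAlgebra (MulEquiv.isField (B := F) hF ?_)
  exact (htop ▸ (Subalgebra.topEquiv (R := ℚ) (A := A.endAlgebra)).symm.toMulEquiv :
    A.endAlgebra ≃* F)

/-- **`A` simple ⟺ `End⁰(A) = F`** («`End_Q(A) = ι(F)`»), for a field `F ⊆ End⁰(A)` of degree
`2 dim A`. [cite: Shimura1998, §5.1 Propositions 3, 6] -/
theorem isSimple_iff_eq_top_of_isField (hF : IsField F) (hdeg : Module.finrank ℚ F = 2 * A.dim) :
    A.IsSimple ↔ F = ⊤ := by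
  rw [isSimple_iff_endAlgebra_comm_of_isField F hF hdeg]
  refine ⟨fun hcomm => ?_, fun htop x y => ?_⟩
  · exact (Subalgebra.eq_of_le_of_comm_of_isField F hF hdeg le_top fun x _ y _ => hcomm x y).symm
  · have hx : x ∈ F := htop ▸ Algebra.mem_top
    have hy : y ∈ F := htop ▸ Algebra.mem_top
    exact congrArg Subtype.val (hF.mul_comm ⟨x, hx⟩ ⟨y, hy⟩)

/-- Non-simple `A` with CM by a field `F`: `End⁰(A)` is strictly bigger than `F` and non-commutative
(`A ∼ B^{n+1}` with `n ≥ 1`). [cite: Shimura1998, §5.1 Propositions 3, 6] -/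
theorem exists_not_mem_of_not_isSimple_of_isField (hF : IsField F)
    (hdeg : Module.finrank ℚ F = 2 * A.dim) (hs : ¬ A.IsSimple) : ∃ x : A.endAlgebra, x ∉ F := by
  by_contra h
  push Not at h
  exact hs ((isSimple_iff_eq_top_of_isField F hF hdeg).2 (top_le_iff.1 fun x _ => h x))

end FieldCM

/-! ### §3 The same for a field `K` mapping to `End⁰(A)` -/

section AlgHom

variable {A : AbelianVariety ℂ} {K : Type*} [Field K] [CharZero K] [Module.Finite ℚ K]

/-- **`A` simple ⟺ `φ : K → End⁰(A)` is onto** (every endomorphism of `A` up to isogeny is complex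
multiplication by an element of `K`), for a field `K` with `[K : ℚ] = 2 dim A`.
[cite: Shimura1998, §5.1 Propositions 3, 6] -/
theorem isSimple_iff_surjective_of_algHom (φ : K →ₐ[ℚ] A.endAlgebra)
    (hdeg : Module.finrank ℚ K = 2 * A.dim) : A.IsSimple ↔ Function.Surjective φ := by
  obtain ⟨hF, hd⟩ := isField_range_and_finrank_eq φ hdeg
  rw [isSimple_iff_eq_top_of_isField φ.range hF hd]
  exact AlgHom.range_eq_top φ

/-- **`A` simple ⟺ `End⁰(A)` commutative**, for `φ : K →ₐ[ℚ] End⁰(A)` with `[K : ℚ] = 2 dim A`.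
[cite: Shimura1998, §5.1 Propositions 3, 6] -/
theorem isSimple_iff_endAlgebra_comm_of_algHom (φ : K →ₐ[ℚ] A.endAlgebra)
    (hdeg : Module.finrank ℚ K = 2 * A.dim) : A.IsSimple ↔ ∀ x y : A.endAlgebra, x * y = y * x := by
  obtain ⟨hF, hd⟩ := isField_range_and_finrank_eq φ hdeg
  exact isSimple_iff_endAlgebra_comm_of_isField φ.range hF hd

/-- **`A` simple ⟺ `End⁰(A)` is a field**, for `φ : K →ₐ[ℚ] End⁰(A)` with `[K : ℚ] = 2 dim A`; then
`φ : K ≃ End⁰(A)`. [cite: Shimura1998, §5.1 Propositions 3, 6] -/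
theorem isSimple_iff_isField_endAlgebra_of_algHom (φ : K →ₐ[ℚ] A.endAlgebra)
    (hdeg : Module.finrank ℚ K = 2 * A.dim) : A.IsSimple ↔ IsField A.endAlgebra := by
  obtain ⟨hF, hd⟩ := isField_range_and_finrank_eq φ hdeg
  exact isSimple_iff_isField_endAlgebra_of_isField φ.range hF hd

/-- For simple `A` and `φ : K →ₐ[ℚ] End⁰(A)` with `[K : ℚ] = 2 dim A`, `φ` is a bijection
`K ≅ End⁰(A)`. [cite: Shimura1998, §5.1 Propositions 3, 6] -/
theorem bijective_of_isSimple_of_algHom (φ : K →ₐ[ℚ] A.endAlgebra)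
    (hdeg : Module.finrank ℚ K = 2 * A.dim) (hs : A.IsSimple) : Function.Bijective φ := by
  haveI := nontrivial_endAlgebra_of_finrank_eq (A := A) (K := K) hdeg
  exact ⟨φ.toRingHom.injective, (isSimple_iff_surjective_of_algHom φ hdeg).1 hs⟩

/-- **`A` simple ⟺ `ψ : K →+* End⁰(A)` is onto**, ring-homomorphism form (`ψ` is automatically
`ℚ`-linear, `RingHom.toRatAlgHom`). [cite: Shimura1998, §5.1 Propositions 3, 6] -/
theorem isSimple_iff_surjective_of_ringHom (ψ : K →+* A.endAlgebra)
    (hdeg : Module.finrank ℚ K = 2 * A.dim) : A.IsSimple ↔ Function.Surjective ψ :=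
  isSimple_iff_surjective_of_algHom ψ.toRatAlgHom hdeg

end AlgHom

end Literature.AlgebraicGeometry.ComplexMultiplication

end
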